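import Summits.QuantumFields.BalabanUV.T4Continuum.Spine.NE9.DirectPairing

/-!
# T⁴ programme, spine estimate NE9 — IN KING'S CURRENCY THE GEOMETRIC RATE OF TOWER-NE5 IS NOT LOAD-BEARING EITHER: a tower rate with ANY
# SUMMABLE profile `r_m` (`|F (m+1) g − F m (g ∘ succ)| ≤ r_m`, `Σ r < ∞`) gives the same END as `DirectPairing` (bracket majorant → 0, uniformly in
# the gap `n`), every geometric constant `C₅θ^m∕(1−θ)` being replaced by the TAIL `R_m = Σ_{l≥m} r_l → 0` — census item C31 of cell `pub-balaban-gaps`,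
# seat ne9 (gen 6)

Cell `pub-balaban-gaps` (YM blitz G2, seat ne9, unit `pub-balaban-gaps-ne9-g6`; record `run/shared/lean/pub/pub-balaban-gaps/ne/NE9.md` §5 row C31).
Summits-side bookkeeping on gen 3's abstract tower; no definition; by-name inputs `DirectPairing.shift_iter_mem` ∕ `chain_le`.

WHY.  Row C30 (`DirectPairing`, `DirectPairingCauchy`) moved node U6 to King's direct organisation ([King1986] §3.2: cutoffs `K`, `K + n` compared at once,
remainders → 0 uniformly in `n`) and found the E-side debt of node U3 → U6 to be separate uniform continuity, GIVEN tower-NE5 with its GEOMETRIC rate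
`C₅θ^m` (`T4OutputRate.NE5`'s shape).  The geometric rate was spent in exactly three places — the `n` unpaired couplings (`iter_towerRate`:
`Σ_{t<n} C₅θ^{m+t} ≤ C₅θ^m∕(1−θ)`), the old block (`MemoryFromRate.osc_le_of_towerRate`: `2C₅θ^A∕(1−θ)`), the descent of `levelUniform_of_towerRate` — and in
each only through a TAIL SUM of the rate.  This file re-runs the chain with an arbitrary nonnegative SUMMABLE rate profile `r` and its tails
`R_m = Σ_l r_{l+m}` (`→ 0` by `tendsto_sum_nat_add`): §1 `iter_rate` (`≤ R_m`, uniformly in `n`), `osc_rate` (`≤ 2R_m`); §2 `levelUniform_of_summableRate`;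
§3 `bracket_eventually_le_of_summableRate`, `directBracket_eventually_le_of_summableRate`; §4 `geometric_is_summableRate` (the geometric case is an
instance).  CONTRAST: in the CONSECUTIVE currency the old-block bound enters a SUM over the levels (`MemoryFromRate.summable_majorant_bounded`:
`Σ_m 2C₅θ^{m∕2}∕(1−θ)`), i.e. `Σ_m R_{m∕2} < ∞` ⟺ a finite FIRST MOMENT `Σ_m m·r_m < ∞` of the rate; in King's currency summability `Σ r < ∞` is all
that is used.  So in the direct organisation NEITHER the E-side modulus (C30) NOR the geometric form of NE5's UV-insensitivity rate is load-bearing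
for node U3 → U6: «UV-insensitivity with a summable rate + separate uniform continuity per young coupling» is the whole E-side input.

VERDICT FOR THE ROW.  NEUTRAL for the classification of NE9 (WORK-bound on W1) and of NE5 (the rate, geometric or summable, is Bałaban's one-step
UV-insensitivity — row NE5's object); it records which FORM of NE5 the E-side junction needs in King's currency (cc row NE5).  Nothing instantiated
(instance 0∕1).

HONEST FRAMING: real analysis on hypothesis SHAPES; tower-NE5 is the cell's estimate NE5 (NOT PRINTED, NOT PROVED; print: [Balaban1987RG1] Thm 1
p. 259 uniformity in the lattice spacing only); NE9 NOT PRINTED ∕ NOT PROVED; spine PROVED 0∕9 unchanged; rung (B)+1 on ONE finite four-torus; NOT UV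
stability, NOT the continuum limit, NOT infinite volume, NOT a mass gap, NOT Clay.

References (TYPES only): [Balaban1987RG1] = T. Bałaban, Commun. Math. Phys. **109** (1987) 249–301, Thm 1 p. 259; [King1986] = C. King, Commun. Math.
Phys. **102** (1986) 649–677, §3.2 pp. 656–657.
-/

namespace Summit.QuantumFields.BalabanUV.T4Continuum.NE9.DirectPairingSummableRate

open scoped BigOperators
open Finset Filter Topology
open Summit.QuantumFields.BalabanUV.T4Continuum.NE9.DirectPairing (shift_iter_mem chain_le)

variable {W : Set (ℕ → ℝ)} {F : ℕ → (ℕ → ℝ) → ℝ} {r : ℕ → ℝ}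

/-! ## §1 Tails of a summable rate; vertical iteration and oscillation under a general rate profile -/

/-- A partial sum of a nonnegative summable rate from `m` on is at most the TAIL `R_m = Σ_l r_{l+m}`. [folklore] -/
theorem sum_range_le_tail (hr0 : ∀ m, 0 ≤ r m) (hrs : Summable r) (m n : ℕ) :
    ∑ t ∈ range n, r (m + t) ≤ ∑' l, r (l + m) := by
  have hs : Summable (fun l => r (l + m)) := (summable_nat_add_iff m).2 hrs
  calc ∑ t ∈ range n, r (m + t) = ∑ t ∈ range n, r (t + m) := sum_congr rfl fun t _ => by rw [add_comm]
    _ ≤ ∑' l, r (l + m) := hs.sum_le_tsum _ fun l _ => hr0 _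

/-- The tails are nonnegative. [folklore] -/
theorem tail_nonneg (hr0 : ∀ m, 0 ≤ r m) (m : ℕ) : 0 ≤ ∑' l, r (l + m) :=
  tsum_nonneg fun _ => hr0 _

/-- The tails tend to zero (`tendsto_sum_nat_add`); ε-form. [folklore] -/
theorem exists_tail_le (r : ℕ → ℝ) {ε : ℝ} (hε : 0 < ε) : ∃ M : ℕ, ∀ m, M ≤ m → ∑' l, r (l + m) ≤ ε := by
  obtain ⟨M, hM⟩ := Metric.tendsto_atTop.mp (tendsto_sum_nat_add r) ε hε
  refine ⟨M, fun m hm => ?_⟩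
  have h := hM m hm
  rw [Real.dist_eq, sub_zero] at h
  exact (le_abs_self _).trans h.le

/-- **VERTICAL ITERATION UNDER A GENERAL RATE**: `|F (m+n) g − F m (g ∘ (·+n))| ≤ Σ_{t<n} r_{m+t}` on a shift-closed window. [folklore] -/
theorem iter_rate_sum
    (hW : ∀ g ∈ W, (fun i => g (i + 1)) ∈ W)
    (hT : ∀ m, ∀ g ∈ W, |F (m + 1) g - F m (fun i => g (i + 1))| ≤ r m) :
    ∀ (n m : ℕ) (g : ℕ → ℝ), g ∈ W → |F (m + n) g - F m (fun i => g (i + n))| ≤ ∑ t ∈ range n, r (m + t) := by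
  intro n
  induction n with
  | zero =>
    intro m g _
    simp
  | succ n ih =>
    intro m g hg
    have h1 : |F (m + n + 1) g - F (m + n) (fun i => g (i + 1))| ≤ r (m + n) := hT (m + n) g hg
    have h2 : |F (m + n) (fun i => g (i + 1)) - F m (fun i => g (i + n + 1))| ≤ ∑ t ∈ range n, r (m + t) :=
      ih m (fun i => g (i + 1)) (hW g hg)
    have e : (fun i => g (i + n + 1)) = fun i => g (i + (n + 1)) := funext fun i => congrArg g (by omega)
    rw [e] at h2
    rw [sum_range_succ, show m + (n + 1) = m + n + 1 from rfl]
    have t := abs_sub_le (F (m + n + 1) g) (F (m + n) fun i => g (i + 1)) (F m fun i => g (i + (n + 1)))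
    linarith

/-- … hence `≤ R_m`, UNIFORMLY IN `n` (`r ≥ 0` summable). [folklore] -/
theorem iter_rate (hr0 : ∀ m, 0 ≤ r m) (hrs : Summable r)
    (hW : ∀ g ∈ W, (fun i => g (i + 1)) ∈ W)
    (hT : ∀ m, ∀ g ∈ W, |F (m + 1) g - F m (fun i => g (i + 1))| ≤ r m)
    (n m : ℕ) {g : ℕ → ℝ} (hg : g ∈ W) :
    |F (m + n) g - F m (fun i => g (i + n))| ≤ ∑' l, r (l + m) :=
  (iter_rate_sum hW hT n m g hg).trans (sum_range_le_tail hr0 hrs m n)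

/-- **OSCILLATION UNDER A GENERAL RATE** (peeling the old couplings): two admissible histories agreeing at all indices `≥ a` have
`|F (m+a) g − F (m+a) g'| ≤ 2·Σ_{t<a} r_{m+t}` — gen 3's `osc_le_sum_of_towerRate` with `C₅θ^·` replaced by `r`. [folklore] -/
theorem osc_rate_sum
    (hW : ∀ g ∈ W, (fun i => g (i + 1)) ∈ W)
    (hT : ∀ m, ∀ g ∈ W, |F (m + 1) g - F m (fun i => g (i + 1))| ≤ r m) :
    ∀ (a m : ℕ) (g g' : ℕ → ℝ), g ∈ W → g' ∈ W → (∀ i, a ≤ i → g i = g' i) →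
      |F (m + a) g - F (m + a) g'| ≤ 2 * ∑ t ∈ range a, r (m + t) := by
  intro a
  induction a with
  | zero =>
    intro m g g' _ _ hagree
    have : g = g' := funext fun i => hagree i (Nat.zero_le i)
    simp [this]
  | succ a ih =>
    intro m g g' hg hg' hagree
    rw [← add_assoc, sum_range_succ]
    have h1 := hT (m + a) g hg
    have h2 := hT (m + a) g' hg'
    have h3 := ih m (fun i => g (i + 1)) (fun i => g' (i + 1)) (hW g hg) (hW g' hg')
      (fun i hi => hagree (i + 1) (by omega))
    have t1 := abs_sub_le (F (m + a + 1) g) (F (m + a) fun i => g (i + 1)) (F (m + a + 1) g')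
    have t2 := abs_sub_le (F (m + a) fun i => g (i + 1)) (F (m + a) fun i => g' (i + 1)) (F (m + a + 1) g')
    rw [abs_sub_comm] at h2
    linarith

/-- … hence `≤ 2R_m` (`r ≥ 0` summable). [folklore] -/
theorem osc_rate (hr0 : ∀ m, 0 ≤ r m) (hrs : Summable r)
    (hW : ∀ g ∈ W, (fun i => g (i + 1)) ∈ W)
    (hT : ∀ m, ∀ g ∈ W, |F (m + 1) g - F m (fun i => g (i + 1))| ≤ r m)
    {a m : ℕ} {g g' : ℕ → ℝ} (hg : g ∈ W) (hg' : g' ∈ W) (hagree : ∀ i, a ≤ i → g i = g' i) :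
    |F (m + a) g - F (m + a) g'| ≤ 2 * ∑' l, r (l + m) :=
  (osc_rate_sum hW hT a m g g' hg hg' hagree).trans (by linarith [sum_range_le_tail hr0 hrs m a])

/-! ## §2 Level-uniformity at fixed age from per-level separate uniform continuity, under a summable rate -/

/-- **LEVEL-UNIFORMITY IS INHERITED FROM A SUMMABLE TOWER RATE** (`DirectPairing.levelUniform_of_towerRate` with the descent cost `R_M` in place of
`C₅θ^M∕(1−θ)`). [folklore] -/
theorem levelUniform_of_summableRate (hr0 : ∀ m, 0 ≤ r m) (hrs : Summable r)
    (hW : ∀ g ∈ W, (fun i => g (i + 1)) ∈ W)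
    (hT : ∀ m, ∀ g ∈ W, |F (m + 1) g - F m (fun i => g (i + 1))| ≤ r m)
    (hUC : ∀ m i : ℕ, i < m → ∀ ε : ℝ, 0 < ε → ∃ δ : ℝ, 0 < δ ∧ ∀ g ∈ W, ∀ g' ∈ W,
      (∀ k, k ≠ i → g k = g' k) → |g i - g' i| ≤ δ → |F m g - F m g'| ≤ ε)
    {a : ℕ} (ha : 1 ≤ a) {ε : ℝ} (hε : 0 < ε) :
    ∃ δ : ℝ, 0 < δ ∧ ∀ m : ℕ, a ≤ m → ∀ g ∈ W, ∀ g' ∈ W,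
      (∀ k, k ≠ m - a → g k = g' k) → |g (m - a) - g' (m - a)| ≤ δ → |F m g - F m g'| ≤ ε := by
  obtain ⟨M₁, hM₁⟩ := exists_tail_le r (show 0 < ε / 3 by positivity)
  obtain ⟨M, hMM, hMa⟩ : ∃ M, M₁ ≤ M ∧ a ≤ M := ⟨max M₁ a, le_max_left _ _, le_max_right _ _⟩
  have hlev : ∀ m : ℕ, ∃ δ : ℝ, 0 < δ ∧ (a ≤ m → ∀ g ∈ W, ∀ g' ∈ W,
      (∀ k, k ≠ m - a → g k = g' k) → |g (m - a) - g' (m - a)| ≤ δ → |F m g - F m g'| ≤ ε / 3) := by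
    intro m
    by_cases ham : a ≤ m
    · obtain ⟨δ, hδ, h⟩ := hUC m (m - a) (by omega) (ε / 3) (by positivity)
      exact ⟨δ, hδ, fun _ => h⟩
    · exact ⟨1, one_pos, fun h => absurd h ham⟩
  choose δf hδf hF using hlev
  refine ⟨(range (M + 1)).inf' ⟨0, by simp⟩ δf, (Finset.lt_inf'_iff _).2 fun m _ => hδf m, ?_⟩
  intro m ham g hg g' hg' hagree hdiff
  by_cases hmM : m ≤ M
  · have hδm : (range (M + 1)).inf' ⟨0, by simp⟩ δf ≤ δf m := Finset.inf'_le δf (mem_range.2 (by omega))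
    have := hF m ham g hg g' hg' hagree (hdiff.trans hδm)
    linarith
  · obtain ⟨l, rfl⟩ := Nat.exists_eq_add_of_le (le_of_lt (not_le.mp hmM))
    have hgl : (fun i => g (i + l)) ∈ W := shift_iter_mem hW l g hg
    have hg'l : (fun i => g' (i + l)) ∈ W := shift_iter_mem hW l g' hg'
    have hdesc : ∑' t, r (t + M) ≤ ε / 3 := hM₁ M hMM
    have d1 := iter_rate hr0 hrs hW hT l M hg
    have d2 := iter_rate hr0 hrs hW hT l M hg'
    have hδM : (range (M + 1)).inf' ⟨0, by simp⟩ δf ≤ δf M := Finset.inf'_le δf (by simp)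
    have hmid : |F M (fun i => g (i + l)) - F M (fun i => g' (i + l))| ≤ ε / 3 := by
      refine hF M hMa _ hgl _ hg'l (fun k hk => hagree (k + l) (by omega)) ?_
      show |g (M - a + l) - g' (M - a + l)| ≤ δf M
      rw [show M - a + l = M + l - a by omega]
      exact hdiff.trans hδM
    have t1 := abs_sub_le (F (M + l) g) (F M fun i => g (i + l)) (F (M + l) g')
    have t2 := abs_sub_le (F M fun i => g (i + l)) (F M fun i => g' (i + l)) (F (M + l) g')
    rw [abs_sub_comm] at d2
    linarith

/-! ## §3 The bracket majorant tends to zero under a summable rate -/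

/-- **THE BRACKET MAJORANT TENDS TO ZERO, SUMMABLE RATE** (`DirectPairing.bracket_eventually_le` with the old block bounded by `2R_A`). [folklore] -/
theorem bracket_eventually_le_of_summableRate {P : ℕ → ℝ} (hr0 : ∀ m, 0 ≤ r m) (hrs : Summable r)
    (hW : ∀ g ∈ W, (fun i => g (i + 1)) ∈ W)
    (hWmix : ∀ g ∈ W, ∀ g' ∈ W, ∀ a : ℕ, (fun i => if i < a then g' i else g i) ∈ W)
    (hT : ∀ m, ∀ g ∈ W, |F (m + 1) g - F m (fun i => g (i + 1))| ≤ r m)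
    (hP : ∀ m, ∀ g ∈ W, ∀ g' ∈ W, (∀ i, i < m → g i = g' i) → F m g = F m g')
    (hUC : ∀ m i : ℕ, i < m → ∀ ε : ℝ, 0 < ε → ∃ δ : ℝ, 0 < δ ∧ ∀ g ∈ W, ∀ g' ∈ W,
      (∀ k, k ≠ i → g k = g' k) → |g i - g' i| ≤ δ → |F m g - F m g'| ≤ ε)
    (hd : Tendsto P atTop (𝓝 0)) {η : ℝ} (hη : 0 < η) :
    ∃ M₀ : ℕ, ∀ m : ℕ, M₀ ≤ m → ∀ g ∈ W, ∀ g' ∈ W,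
      (∀ i, i < m → |g i - g' i| ≤ P i) → |F m g - F m g'| ≤ η := by
  obtain ⟨A₁, hA₁⟩ := exists_tail_le r (show 0 < η / 4 by positivity)
  obtain ⟨A, hAA, hA1⟩ : ∃ A, A₁ ≤ A ∧ 1 ≤ A := ⟨max A₁ 1, le_max_left _ _, le_max_right _ _⟩
  have hAold : ∑' t, r (t + A) ≤ η / 4 := hA₁ A hAA
  have hApos : (0 : ℝ) < A := by exact_mod_cast hA1
  have hage : ∀ a : ℕ, ∃ δ : ℝ, 0 < δ ∧ (1 ≤ a → ∀ m : ℕ, a ≤ m → ∀ g ∈ W, ∀ g' ∈ W,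
      (∀ k, k ≠ m - a → g k = g' k) → |g (m - a) - g' (m - a)| ≤ δ → |F m g - F m g'| ≤ η / (2 * A)) := by
    intro a
    by_cases ha : 1 ≤ a
    · obtain ⟨δ, hδ, h⟩ :=
        levelUniform_of_summableRate hr0 hrs hW hT hUC ha (show 0 < η / (2 * A) by positivity)
      exact ⟨δ, hδ, fun _ => h⟩
    · exact ⟨1, one_pos, fun h => absurd h ha⟩
  choose δa hδa hFa using hage
  have hδpos : 0 < (range (A + 1)).inf' ⟨0, by simp⟩ δa := (Finset.lt_inf'_iff _).2 fun a _ => hδa a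
  have hδle : ∀ a, a ≤ A → (range (A + 1)).inf' ⟨0, by simp⟩ δa ≤ δa a :=
    fun a ha => Finset.inf'_le δa (mem_range.2 (by omega))
  obtain ⟨I, hI⟩ := Metric.tendsto_atTop.mp hd _ hδpos
  have hPI : ∀ i, I ≤ i → P i ≤ (range (A + 1)).inf' ⟨0, by simp⟩ δa := fun i hi => by
    have h := hI i hi
    rw [Real.dist_eq, sub_zero] at h
    exact (le_abs_self _).trans h.le
  refine ⟨I + A, fun m hm g hg g' hg' hgg' => ?_⟩
  have hh₀W : (fun i => if i < m - A then g' i else g i) ∈ W := hWmix g hg g' hg' (m - A)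
  have hold : |F m g - F m (fun i => if i < m - A then g' i else g i)| ≤ η / 2 := by
    have h := osc_rate (F := F) hr0 hrs hW hT (a := m - A) (m := A) hg hh₀W (fun i hi => by simp [not_lt.mpr hi])
    rw [show A + (m - A) = m by omega] at h
    linarith
  have hyoung : |F m (fun i => if i < m - A then g' i else g i) -
      F m (fun i => if i < m - A + A then g' i else g i)| ≤ (A : ℝ) * (η / (2 * A)) := by
    refine chain_le hWmix hg hg' (fun i hi1 hi2 h hh h' hh' hagree hdi => ?_)
      (fun i _ hi2 => hgg' i hi2) A (by omega)
    have him : m - (m - i) = i := by omega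
    refine hFa (m - i) (by omega) m (by omega) h hh h' hh' (by rw [him]; exact hagree) ?_
    rw [him]
    exact hdi.trans ((hPI i (by omega)).trans (hδle _ (by omega)))
  have hlast : F m (fun i => if i < m - A + A then g' i else g i) = F m g' :=
    hP m _ (hWmix g hg g' hg' _) g' hg' (fun i hi => by simp [show i < m - A + A by omega])
  have eA : (A : ℝ) * (η / (2 * A)) = η / 2 := by
    field_simp
  rw [hlast, eA] at hyoung
  have t := abs_sub_le (F m g) (F m fun i => if i < m - A then g' i else g i) (F m g')
  linarith

/-- **KING'S CURRENCY, E-SIDE END, SUMMABLE RATE**: `|F (m+n) g − F m g'| ≤ η` beyond a level, uniformly in `n` — the unpaired couplings cost the tail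
`R_m` (`iter_rate`). [folklore] -/
theorem directBracket_eventually_le_of_summableRate {P : ℕ → ℝ} (hr0 : ∀ m, 0 ≤ r m) (hrs : Summable r)
    (hW : ∀ g ∈ W, (fun i => g (i + 1)) ∈ W)
    (hWmix : ∀ g ∈ W, ∀ g' ∈ W, ∀ a : ℕ, (fun i => if i < a then g' i else g i) ∈ W)
    (hT : ∀ m, ∀ g ∈ W, |F (m + 1) g - F m (fun i => g (i + 1))| ≤ r m)
    (hP : ∀ m, ∀ g ∈ W, ∀ g' ∈ W, (∀ i, i < m → g i = g' i) → F m g = F m g')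
    (hUC : ∀ m i : ℕ, i < m → ∀ ε : ℝ, 0 < ε → ∃ δ : ℝ, 0 < δ ∧ ∀ g ∈ W, ∀ g' ∈ W,
      (∀ k, k ≠ i → g k = g' k) → |g i - g' i| ≤ δ → |F m g - F m g'| ≤ ε)
    (hd : Tendsto P atTop (𝓝 0)) {η : ℝ} (hη : 0 < η) :
    ∃ M₀ : ℕ, ∀ m : ℕ, M₀ ≤ m → ∀ n : ℕ, ∀ g ∈ W, ∀ g' ∈ W,
      (∀ i, i < m → |g (i + n) - g' i| ≤ P i) → |F (m + n) g - F m g'| ≤ η := by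
  obtain ⟨M₁, hM₁⟩ := exists_tail_le r (half_pos hη)
  obtain ⟨M₂, hM₂⟩ := bracket_eventually_le_of_summableRate hr0 hrs hW hWmix hT hP hUC hd (half_pos hη)
  refine ⟨max M₁ M₂, fun m hm n g hg g' hg' hgg' => ?_⟩
  have h1 := iter_rate hr0 hrs hW hT n m hg
  have h2 := hM₂ m (le_of_max_le_right hm) (fun i => g (i + n)) (shift_iter_mem hW n g hg) g' hg' hgg'
  have h3 : ∑' l, r (l + m) ≤ η / 2 := hM₁ m (le_of_max_le_left hm)
  have t := abs_sub_le (F (m + n) g) (F m fun i => g (i + n)) (F m g')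
  linarith

/-! ## §4 The geometric rate is an instance -/

/-- The geometric rate `C₅θ^m` of `T4OutputRate.NE5`'s shape (`C₅ ≥ 0`, `0 ≤ θ < 1`) is a nonnegative summable rate profile — so `DirectPairing`'s END is the
special case `r m = C₅θ^m` of this file's. [folklore] -/
theorem geometric_is_summableRate {C₅ θ : ℝ} (hC : 0 ≤ C₅) (hθ0 : 0 ≤ θ) (hθ1 : θ < 1) :
    (∀ m, 0 ≤ C₅ * θ ^ m) ∧ Summable (fun m => C₅ * θ ^ m) :=
  ⟨fun m => mul_nonneg hC (pow_nonneg hθ0 m), (summable_geometric_of_lt_one hθ0 hθ1).mul_left C₅⟩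

/-- The tails of a nonnegative summable rate profile are bounded by its total (and tend to zero, `exists_tail_le`) — together with `sum_range_le_tail` this
is ALL that King's organisation uses of the rate; the consecutive organisation sums the tails over the levels (a first moment). [folklore] -/
theorem tail_le_tsum (hr0 : ∀ m, 0 ≤ r m) (hrs : Summable r) (m : ℕ) : ∑' l, r (l + m) ≤ ∑' l, r l := by
  rw [← hrs.sum_add_tsum_nat_add m]
  exact le_add_of_nonneg_left (sum_nonneg fun i _ => hr0 i)

/-! ## §5 (appended 2026-08-23, same seat) Summability of the rate is NECESSARY for the n-uniform END — two-sidedness of the rate condition: the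
history-independent accumulating tower `F m g = Σ_{l<m} r_l` has tower rate `r` exactly, and its direct bracket is eventually `≤ η` uniformly in the gap only
if `Σ r < ∞` (`summable_of_directSmall`, `exists_tower_not_directSmall`) -/

/-- **THE ACCUMULATING TOWER.**  For ANY nonnegative rate profile `r` the history-INDEPENDENT tower `F m g = Σ_{l<m} r_l` has the tower rate `r` exactly
(`F (m+1) g − F m (g ∘ succ) = r_m`), prefix dependence and separate uniform continuity trivially (it does not read the couplings at all), and its DIRECT
bracket is the block sum `F (m+n) g − F m g' = Σ_{l<n} r_{m+l}`. [folklore] -/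
theorem accumulating_direct (r : ℕ → ℝ) (m n : ℕ) (g g' : ℕ → ℝ) :
    (fun (m : ℕ) (_ : ℕ → ℝ) => ∑ l ∈ range m, r l) (m + n) g - (fun (m : ℕ) (_ : ℕ → ℝ) => ∑ l ∈ range m, r l) m g' =
      ∑ t ∈ range n, r (m + t) := by
  simp only
  rw [sum_range_add_sub_sum_range]

/-- **SUMMABILITY OF THE RATE IS NECESSARY.**  If for the accumulating tower of a nonnegative rate `r` the conclusion of
`directBracket_eventually_le_of_summableRate` holds for ONE pair of histories and ONE tolerance `η` (some level `M₀` beyond which `|F (m+n) g − F m g'| ≤ η`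
for ALL `n`), then `r` is summable: the partial sums are bounded by `Σ_{l<M₀} r_l + η`.  So in King's currency «UV-insensitivity with a SUMMABLE rate» is
exactly what the n-uniform END needs of tower-NE5 — not less (this theorem), not more (§3). [folklore] -/
theorem summable_of_directSmall {r : ℕ → ℝ} (hr0 : ∀ m, 0 ≤ r m) {η : ℝ} {M₀ : ℕ} {g g' : ℕ → ℝ}
    (h : ∀ n : ℕ, |(fun (m : ℕ) (_ : ℕ → ℝ) => ∑ l ∈ range m, r l) (M₀ + n) g -
      (fun (m : ℕ) (_ : ℕ → ℝ) => ∑ l ∈ range m, r l) M₀ g'| ≤ η) :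
    Summable r := by
  refine summable_of_sum_range_le (c := ∑ l ∈ range M₀, r l + η) hr0 fun N => ?_
  have hη : 0 ≤ η := (abs_nonneg _).trans (h 0)
  rcases le_or_gt N M₀ with hN | hN
  · calc ∑ l ∈ range N, r l ≤ ∑ l ∈ range M₀, r l := sum_le_sum_of_subset_of_nonneg (range_mono hN) fun l _ _ => hr0 l
      _ ≤ ∑ l ∈ range M₀, r l + η := le_add_of_nonneg_right hη
  · obtain ⟨n, rfl⟩ := Nat.exists_eq_add_of_le hN.le
    have hb := h n
    rw [accumulating_direct r M₀ n g g', abs_of_nonneg (sum_nonneg fun t _ => hr0 _)] at hb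
    rw [← sum_range_add_sum_Ico _ (Nat.le_add_right M₀ n)]
    have e : ∑ l ∈ Ico M₀ (M₀ + n), r l = ∑ t ∈ range n, r (M₀ + t) := by
      rw [sum_Ico_eq_sum_range, Nat.add_sub_cancel_left]
    rw [e]
    linarith

/-- **PACKAGED NECESSITY**: a nonnegative rate profile that is NOT summable admits a tower on ANY window with that exact tower rate, prefix dependence,
separate uniform continuity (trivially — it is history-independent), whose direct bracket is NOT eventually `≤ η` uniformly in the gap `n`, for every
`η` and every pair of histories. [folklore] -/
theorem exists_tower_not_directSmall {r : ℕ → ℝ} (hr0 : ∀ m, 0 ≤ r m) (hrs : ¬ Summable r) (W : Set (ℕ → ℝ)) :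
    ∃ F : ℕ → (ℕ → ℝ) → ℝ,
      (∀ m g, F (m + 1) g - F m (fun i => g (i + 1)) = r m) ∧
      (∀ m g g', F m g = F m g') ∧
      ∀ (η : ℝ) (M₀ : ℕ), ∀ g ∈ W, ∀ g' ∈ W, ∃ m n : ℕ, M₀ ≤ m ∧ η < |F (m + n) g - F m g'| := by
  refine ⟨fun m _ => ∑ l ∈ range m, r l, fun m g => by simp [sum_range_succ], fun m g g' => rfl, fun η M₀ g _ g' _ => ?_⟩
  by_contra hcon
  push Not at hcon
  exact hrs (summable_of_directSmall (M₀ := M₀) (g := g) (g' := g') hr0 fun n => hcon M₀ n le_rfl)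

end Summit.QuantumFields.BalabanUV.T4Continuum.NE9.DirectPairingSummableRate
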